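import Literature.NumberTheory.Automorphic.RankOneAssembly
import Literature.NumberTheory.Automorphic.RankOneBorelBruhat
import Literature.NumberTheory.Automorphic.RootSubgroupProofsHolds
import Literature.NumberTheory.Automorphic.BorelParabolic
import HarnessLib

/-!
# Springer's relations (19), (20) in semisimple rank one: reduction to 7.3.3 (ii) alone
(trunk T-AUTOMORPHIC, G25 AutomorphicL; lang.S13 (b); Springer 7.2.2 (i), 7.2.3 (i), 7.2.4)

Companion (`…Proofs`) to `ReductiveDualRelations.lean`, whose named fact
`exists_rankOneRelations_of_central` — Springer, *Linear Algebraic Groups*, 2nd ed., 7.2.4,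
formulas (19), (20): in a connected reductive `G` of semisimple rank one (a root `α` with
`(Ker α)°` central) there are `u = u_α`, `t = λ`, a Weyl element `n` and `m m' = 2` with
`n u(y) n⁻¹ = u(-y⁻¹) n t(y^{m'}) u(-y⁻¹)`, `n² = t((-1)^{m'})`, `t(z) u(x) t(z)⁻¹ = u(z^m x)`,
`n t(z) n⁻¹ = t(z⁻¹)` — the tree already derives (`ReductiveDualBruhat.lean`,
`RankOneAssembly.lean`) from the Bruhat decomposition 7.2.2 (i) (`bruhat_rankOne_of_central`),
itself derived (`RankOneOrbitBruhat.bruhat_of_isBorelIn`, the `k`-points analysis of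
`G/B ≅ ℙ¹`) from four inputs: `atMostTwo_isBorelIn_of_central` (7.1.4/6.4.12),
`exists_rootHom_sup_isBorelIn_of_central` (7.3.3 (ii)), `centralizer_eq_of_isMaximalTorusIn`
(7.6.4 (ii): `Z_G(T) = T`) and `isClosed_orbitCone_of_borel_le_lineStabilizer` (6.2.7 (ii)).
Of these, 7.1.4 (`atMostTwo_isBorelIn_of_central_holds`), 6.2.7 (ii)
(`isClosed_orbitCone_of_borel_le_lineStabilizer_holds`), 6.2.7 (iii) (`isBorelIn_conj_holds`) and
6.4.8 (ii) (`centralizer_le_of_isBorelIn_holds`: a Borel subgroup containing a maximal torus `T`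
contains `Z_G(T)`) are now theorems of the tree. This file removes the dependence on 7.6.4 (ii):

* `inf_centralizer_eq_of_isBorelIn_sup` (**proved**, Springer 7.2.3 (i), printed argument:
  "*it lies in the centralizer of `T`, which is … contained in `B` by 6.4.8 (ii) … It follows
  that `Z_G(T) = T`*"): if `B = T · u(𝔾ₐ)` is a Borel subgroup for a root homomorphism `u` of a
  non-trivial character, then `Z_G(T) = T` — an element `t u(y)` of `B` centralising `T` has
  `y = 0` (`IsRootHom.eq_zero_of_torus_mul_uval_mem_normalizer`);
* `exists_rankOneOrbitData_of_centralizer_eq` (**proved**): the rank-one orbit data of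
  `RankOneOrbit.lean` (Chevalley's 5.5.3 for `B`, diagonalisation of `ρ(T)`, closed orbit cone)
  from the *pointwise* hypothesis `Z_G(T) = T` — the construction of
  `RankOneOrbitBruhat.exists_rankOneOrbitData` verbatim, which instead consumes the universally
  quantified named fact `centralizer_eq_of_isMaximalTorusIn`;
* `bruhat_rankOne_of_central_of_rootHomBorel` (**proved**): the Bruhat decomposition 7.2.2 (i)
  (`bruhat_rankOne_of_central`) from `exists_rootHom_sup_isBorelIn_of_central` alone;
* `exists_rankOneRelations_of_central_of_rootHomBorel` (**proved**): Springer's relations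
  (19), (20) (`exists_rankOneRelations_of_central`) from `exists_rootHom_sup_isBorelIn_of_central`
  alone — so that the discharge `exists_rankOneRelations_of_central_holds` is this theorem applied
  to a proof of 7.3.3 (ii);
* `exists_sl2Realization_of_central_of_rootHomBorel`, `exists_isRootDatumOf_of_rootHomBorel`
  (**proved assemblies**): 8.1.4 (i) in semisimple rank one from 7.3.3 (ii) alone, and lang.S13 (b)
  (`exists_isRootDatumOf`, 7.4.3) from the two named facts 7.6.4 (i)
  (`isConnectedReductive_centralizer_torus`) and 7.3.3 (ii)
  (`exists_rootHom_sup_isBorelIn_of_central`);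
* `exists_rankOneRelations_of_central_holds` (**the discharge**): 7.3.3 (ii) is now a theorem of
  the tree (`exists_rootHom_sup_isBorelIn_of_central_holds`, `RankOneBorelBruhat.lean`: the
  rank-one orbit analysis for an arbitrary Borel subgroup `B ⊇ T · U_α` and `B = T · U_α`), so
  Springer's relations (19), (20) hold unconditionally.

No new definitions or named facts.

## Mathlib

No linear algebraic groups in Mathlib; `Subgroup.centralizer`, `Subgroup.normalizer`,
`Subgroup.mem_sup`-algebra only. Nothing here duplicates a Mathlib declaration; the body of
`exists_rankOneOrbitData_of_centralizer_eq` deliberately repeats that of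
`exists_rankOneOrbitData` with a weaker hypothesis (searched `rankOneOrbitData`,
`centralizer_eq`, `rootHomBorel`).

## References

* [SpringerLAG1998] T. A. Springer, *Linear Algebraic Groups*, 2nd ed., Progress in Mathematics 9,
  Birkhäuser (1998): 6.4.8 (ii), 7.2.1–7.2.4 with formulas (18)–(20), 7.3.2–7.3.3, 7.4.3, 7.6.4,
  8.1.4 (i).
-/

open scoped MatrixGroups IsMulCommutative
open Matrix

namespace Literature.NumberTheory.Automorphic

variable {k : Type*} [Field k] {n : Type*} [Fintype n] [DecidableEq n]

/-! ### `Z_G(T) = T` when `T · U_α` is a Borel subgroup (Springer 7.2.3 (i)) -/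

section Centralizer

variable {G T : Subgroup (GL n k)}

/-- **`Z_G(T) = T` in semisimple rank one** (Springer 7.2.3 (i): "*… lies in the centralizer of
`T`, which is connected and contained in `B` by 6.4.8 (ii) … It follows that `Z_G(T) = T`*").
For a Zariski-connected `G ≤ GL n k` over an algebraically closed field, a maximal torus `T`, a
root homomorphism `u` for a non-trivial character `α` of `T` such that `B = T · u(𝔾ₐ)` is a Borel
subgroup of `G`: `G ∩ Z(T) = T`. Proof: `Z_G(T) ⊆ B` by 6.4.8 (ii)
(`centralizer_le_of_isBorelIn_holds`), and an element `t u(y)` of `B` centralising `T` has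
`y = 0` (`IsRootHom.eq_zero_of_torus_mul_uval_mem_normalizer`), i.e. lies in `T`.
[cite: SpringerLAG1998, 7.2.3 (i) (proof) with 6.4.8 (ii)] -/
theorem inf_centralizer_eq_of_isBorelIn_sup [IsAlgClosed k] (hG : IsZConnected G)
    (hT : IsMaximalTorusIn T G) {α : ↥(characterLattice T)} (hα1 : (α : ↥T →* kˣ) ≠ 1)
    {u : Multiplicative k →* ↥G} (hu : IsRootHom G T hT.1 (α : ↥T →* kˣ) u)
    (hB : IsBorelIn (T ⊔ u.range.map G.subtype) G) :
    G ⊓ Subgroup.centralizer (T : Set (GL n k)) = T := by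
  have hTtorus : IsTorusSubgroup T := hT.2.1
  haveI : IsMulCommutative ↥T := hTtorus.2.1
  refine le_antisymm (fun x hx => ?_) (fun t ht => ?_)
  · -- `x ∈ Z_G(T) ⊆ B` (6.4.8 (ii)), so `x = t u(y)`; centralising `T` forces `y = 0`
    have hxB : x ∈ T ⊔ u.range.map G.subtype :=
      centralizer_le_of_isBorelIn_holds hG hT hB le_sup_left hx
    obtain ⟨t, ht, y, rfl⟩ := hu.mem_sup_iff.1 hxB
    have hsurj : Function.Surjective (α : ↥T →* kˣ) :=
      surjective_of_ne_one_of_mem_characterLattice hTtorus fun e => hα1 (by rw [e, Subgroup.coe_one])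
    have hy : y = 0 := by
      refine hu.eq_zero_of_torus_mul_uval_mem_normalizer hTtorus hsurj ht fun s => ?_
      have hc := Subgroup.mem_centralizer_iff.1 hx.2 (s : GL n k) s.2
      rw [mul_assoc, hc, inv_mul_cancel_left]
      exact s.2
    rw [hy, uval_zero, mul_one]
    exact ht
  · exact ⟨hT.1 ht, Subgroup.mem_centralizer_iff.2 fun s hs =>
      congrArg Subtype.val (mul_comm (⟨s, hs⟩ : ↥T) ⟨t, ht⟩)⟩

end Centralizer

/-! ### The rank-one orbit data from the pointwise `Z_G(T) = T` -/

section Existence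

variable {G T : Subgroup (GL n k)}

/-- **Existence of the rank-one orbit data, pointwise form** (Springer 7.1.5, proof): as
`RankOneOrbitBruhat.exists_rankOneOrbitData` — Chevalley's theorem 5.5.3 for the algebraic
subgroup `B = T · U_α` (`exists_isAlgebraicGL_lineStabilizer_eq`), simultaneous diagonalisation of
`ρ(T)` (`exists_conj_le_diagonalSubgroup`) and the closed-orbit theorem 6.2.7 (ii)
(`isClosed_orbitCone_of_borel_le_lineStabilizer_holds`) — but with the hypothesis `Z_G(T) = T`
for the given `(G, T)` instead of the named fact `centralizer_eq_of_isMaximalTorusIn`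
(7.6.4 (ii)) for all reductive groups. [cite: SpringerLAG1998, 7.1.5 (proof)] -/
theorem exists_rankOneOrbitData_of_centralizer_eq [IsAlgClosed k]
    (hG : IsConnectedReductive G) (hT : IsMaximalTorusIn T G)
    (hZT : G ⊓ Subgroup.centralizer (T : Set (GL n k)) = T)
    {α : ↥(characterLattice T)} (hα : α ∈ roots G T)
    (hcen : G ≤ Subgroup.centralizer
      ((identityComponent ((α : ↥T →* kˣ).ker.map T.subtype) : Subgroup (GL n k)) : Set (GL n k)))
    {u : Multiplicative k →* ↥G} (hu : IsRootHom G T hT.1 (α : ↥T →* kˣ) u)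
    (hB : IsBorelIn (T ⊔ u.range.map G.subtype) G)
    {m : GL n k} (hmG : m ∈ G) (hmN : m ∈ Subgroup.normalizer (T : Set (GL n k)))
    (hmZ : m ∉ Subgroup.centralizer (T : Set (GL n k))) :
    ∃ (N : ℕ) (ρ : ↥G →* GL (Fin N) k) (v : Fin N → k), RankOneOrbitData G T α u m ρ v := by
  classical
  have hTtorus : IsTorusSubgroup T := hT.2.1
  haveI : IsMulCommutative ↥T := hTtorus.2.1
  -- Chevalley 5.5.3 for `B`
  obtain ⟨N, ρ, v, hρ, hv0, hstab⟩ :=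
    exists_isAlgebraicGL_lineStabilizer_eq (H := T ⊔ u.range.map G.subtype) G hB.2.1.1
  -- diagonalise `ρ(T)`
  set Tρ : Subgroup (GL (Fin N) k) := (T.subgroupOf G).map ρ with hTρ
  have hmemTρ : ∀ {x : GL (Fin N) k}, x ∈ Tρ ↔ ∃ g : ↥G, (g : GL n k) ∈ T ∧ ρ g = x := by
    intro x
    simp only [hTρ, Subgroup.mem_map, Subgroup.mem_subgroupOf]
  have hcommρ : IsMulCommutative ↥Tρ := by
    refine ⟨⟨fun a b => Subtype.ext ?_⟩⟩
    obtain ⟨g, hg, hga⟩ := hmemTρ.1 a.2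
    obtain ⟨g', hg', hgb⟩ := hmemTρ.1 b.2
    rw [Subgroup.coe_mul, Subgroup.coe_mul, ← hga, ← hgb, ← map_mul, ← map_mul]
    congr 1
    exact Subtype.ext (by
      have := congrArg Subtype.val (mul_comm (⟨(g : GL n k), hg⟩ : ↥T) ⟨(g' : GL n k), hg'⟩)
      simpa using this)
  have hssρ : ∀ x ∈ Tρ, IsSemisimpleElt x := by
    intro x hx
    obtain ⟨g, hg, rfl⟩ := hmemTρ.1 hx
    have := IsSemisimpleElt.map_of_isAlgebraicGL hρ g.2 (hTtorus.2.2 _ hg)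
    exact this
  obtain ⟨P, hP⟩ := exists_conj_le_diagonalSubgroup hcommρ hssρ
  -- the conjugated data
  set ρ' : ↥G →* GL (Fin N) k := (MulAut.conj P).toMonoidHom.comp ρ with hρ'
  set v' : Fin N → k := ((P : GL (Fin N) k) : Matrix (Fin N) (Fin N) k) *ᵥ v with hv'
  have hρ'apply : ∀ g : ↥G, ((ρ' g : GL (Fin N) k) : Matrix (Fin N) (Fin N) k) =
      (P : Matrix (Fin N) (Fin N) k) * (ρ g : Matrix (Fin N) (Fin N) k) *
        ((P⁻¹ : GL (Fin N) k) : Matrix (Fin N) (Fin N) k) := by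
    intro g
    simp [hρ', MulAut.conj_apply]
  have hstab' : ∀ g : ↥G, (∃ c : k, ((ρ' g : GL (Fin N) k) : Matrix (Fin N) (Fin N) k) *ᵥ v' = c • v') ↔
      (g : GL n k) ∈ T ⊔ u.range.map G.subtype := by
    intro g
    rw [← hstab g, hρ'apply, hv']
    have hPP : ((P⁻¹ : GL (Fin N) k) : Matrix (Fin N) (Fin N) k) * (P : Matrix (Fin N) (Fin N) k) = 1 := by
      rw [← Units.val_mul, inv_mul_cancel, Units.val_one]
    constructor
    · rintro ⟨c, hc⟩
      refine ⟨c, ?_⟩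
      rw [Matrix.mulVec_mulVec, mul_assoc, hPP, mul_one] at hc
      have := congrArg (fun w => ((P⁻¹ : GL (Fin N) k) : Matrix (Fin N) (Fin N) k) *ᵥ w) hc
      rwa [Matrix.mulVec_mulVec, ← mul_assoc, hPP, one_mul, Matrix.mulVec_smul, Matrix.mulVec_mulVec,
        hPP, Matrix.one_mulVec] at this
    · rintro ⟨c, hc⟩
      refine ⟨c, ?_⟩
      rw [Matrix.mulVec_mulVec, mul_assoc, hPP, mul_one, ← Matrix.mulVec_mulVec, hc,
        Matrix.mulVec_smul]
  refine ⟨N, ρ', v', {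
    conn := hG.1
    maxTorus := hT
    mem_roots := hα
    central := hcen
    rootHom := hu
    borel := hB
    centralizer_eq := hZT
    memG := hmG
    memN := hmN
    notMemZ := hmZ
    algebraic := hρ.conj_comp P
    ne_zero := ?_
    stab_iff := hstab'
    diag := ?_
    closed := ?_ }⟩
  · intro h0
    apply hv0
    have := congrArg (fun w => ((P⁻¹ : GL (Fin N) k) : Matrix (Fin N) (Fin N) k) *ᵥ w) h0
    simpa [hv', Matrix.mulVec_mulVec, ← Units.val_mul] using this
  · intro t
    have hmem : ρ' ⟨t, hT.1 t.2⟩ ∈ Tρ.map (MulAut.conj P).toMonoidHom :=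
      Subgroup.mem_map_of_mem _ (hmemTρ.2 ⟨⟨t, hT.1 t.2⟩, t.2, rfl⟩)
    obtain ⟨d, hd⟩ := hP hmem
    refine ⟨fun i => (d i : k), ?_⟩
    rw [← hd, coe_diagonalGL]
  · exact isClosed_orbitCone_of_borel_le_lineStabilizer_holds hG.1 hB ρ' (hρ.conj_comp P) v'
      fun b hb => (hstab' b).2 hb

end Existence

/-! ### The Bruhat decomposition and the relations (19), (20) from 7.3.3 (ii) alone -/

section Reduction

variable {G T : Subgroup (GL n k)}

/-- **The Bruhat decomposition in semisimple rank one (Springer 7.2.2 (i)) from 7.3.3 (ii)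
alone**: the named fact `bruhat_rankOne_of_central` follows from
`exists_rootHom_sup_isBorelIn_of_central`. For the given root homomorphism `u` of `α`,
`T · u(𝔾ₐ)` is one of the two Borel subgroups containing `T`
(`exists_rootHom_pair_isBorelIn_of_central`, `IsRootHom.map_range_eq_of_central`, with
`atMostTwo_isBorelIn_of_central_holds`); then `Z_G(T) = T`
(`inf_centralizer_eq_of_isBorelIn_sup`, 7.2.3 (i) via 6.4.8 (ii)) and the orbit analysis of
`G/B ≅ ℙ¹` (`RankOneOrbitData.bruhat`, 7.2.2 (i)) applies.
[cite: SpringerLAG1998, 7.2.2 (i) with 7.2.3 (i), 6.4.8 (ii)] -/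
theorem bruhat_rankOne_of_central_of_rootHomBorel
    (hC₂ : exists_rootHom_sup_isBorelIn_of_central (k := k) (n := n)) :
    bruhat_rankOne_of_central (k := k) (n := n) := by
  intro _ G T hG hT α hα hcen u hu m hmG hmN hmZ g hg hgB
  obtain ⟨u', -, hu', -, hB', -, -⟩ :=
    exists_rootHom_pair_isBorelIn_of_central atMostTwo_isBorelIn_of_central_holds hC₂ hG hT hα hcen
  have hEq : u.range.map G.subtype = u'.range.map G.subtype :=
    hu.map_range_eq_of_central atMostTwo_isBorelIn_of_central_holds hC₂ hG hT hα hcen hu'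
  have hB : IsBorelIn (T ⊔ u.range.map G.subtype) G := by rw [hEq]; exact hB'
  have hZT : G ⊓ Subgroup.centralizer (T : Set (GL n k)) = T :=
    inf_centralizer_eq_of_isBorelIn_sup hG.1 hT hα.1 hu hB
  obtain ⟨N, ρ, v, h⟩ :=
    exists_rankOneOrbitData_of_centralizer_eq hG hT hZT hα hcen hu hB hmG hmN hmZ
  exact h.bruhat hg hgB

/-- **Springer's relations (19), (20) (7.2.4) from 7.3.3 (ii) alone**: the named fact
`exists_rankOneRelations_of_central` of `ReductiveDualRelations.lean` follows from
`exists_rootHom_sup_isBorelIn_of_central`, through the Bruhat decomposition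
(`bruhat_rankOne_of_central_of_rootHomBorel`), the Weyl element of 6.4.12
(`exists_bruhatDatum_of_central`, with `isBorelIn_conj_holds` and
`atMostTwo_isBorelIn_of_central_holds`) and the algebra of the first page of the proof of 7.2.4
(`BruhatDatum.exists_rankOneRelations`), assembled in
`exists_rankOneRelations_of_central_of_bruhat`.
[cite: SpringerLAG1998, 7.2.4 (proof, (18)–(20)) with 7.2.2 (i)] -/
theorem exists_rankOneRelations_of_central_of_rootHomBorel
    (hC₂ : exists_rootHom_sup_isBorelIn_of_central (k := k) (n := n)) :
    exists_rankOneRelations_of_central (k := k) (n := n) :=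
  exists_rankOneRelations_of_central_of_bruhat (bruhat_rankOne_of_central_of_rootHomBorel hC₂)
    isBorelIn_conj_holds atMostTwo_isBorelIn_of_central_holds hC₂

/-- **8.1.4 (i) in semisimple rank one from 7.3.3 (ii) alone**: the named fact
`exists_sl2Realization_of_central` (`α` is realised by an algebraic `SL₂ → G`) follows from
`exists_rootHom_sup_isBorelIn_of_central` (`exists_sl2Realization_of_central_of_relations` with
`exists_rankOneRelations_of_central_of_rootHomBorel`).
[cite: SpringerLAG1998, 8.1.4 (i) (proof) with 7.2.4] -/
theorem exists_sl2Realization_of_central_of_rootHomBorel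
    (hC₂ : exists_rootHom_sup_isBorelIn_of_central (k := k) (n := n)) :
    exists_sl2Realization_of_central (k := k) (n := n) :=
  exists_sl2Realization_of_central_of_relations
    (exists_rankOneRelations_of_central_of_rootHomBorel hC₂)

/-- **lang.S13 (b) from two structure-theoretic facts** (Springer 7.4.3): `exists_isRootDatumOf`
— a connected reductive group over an algebraically closed field, with a maximal torus, carries a
reduced root datum — follows from 7.6.4 (i) (`isConnectedReductive_centralizer_torus`: the
centralisers `G_α = Z_G((Ker α)°)` are connected reductive) and 7.3.3 (ii)
(`exists_rootHom_sup_isBorelIn_of_central`: in `G_α` the groups `T · U_{±α}` are distinct Borel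
subgroups); 7.1.4, 6.2.7, 6.4.8 (ii), 7.2.2–7.2.4, 7.3.5, 7.4.3–7.4.4 and 8.1.4 are theorems of
the tree (`exists_isRootDatumOf_of_relations`).
[cite: SpringerLAG1998, 7.4.3 with 7.6.4 (i), 7.3.3 (ii)] -/
theorem exists_isRootDatumOf_of_rootHomBorel
    (hA : isConnectedReductive_centralizer_torus (k := k) (n := n))
    (hC₂ : exists_rootHom_sup_isBorelIn_of_central (k := k) (n := n)) :
    exists_isRootDatumOf (G := G) (T := T) :=
  exists_isRootDatumOf_of_relations hA atMostTwo_isBorelIn_of_central_holds hC₂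
    (exists_rankOneRelations_of_central_of_rootHomBorel hC₂)

end Reduction

/-! ### The discharge -/

section Holds

/-- **Springer 7.2.4, formulas (19), (20), discharged**: the named fact
`exists_rankOneRelations_of_central` of `ReductiveDualRelations.lean` holds — in a connected
reductive `G ≤ GL n k` over an algebraically closed field, with a maximal torus `T` and a root `α`
whose singular torus `(Ker α)°` is central, there are a root homomorphism `u = u_α`, a cocharacter
`t = λ` of `T`, a Weyl element `n ∈ G` acting on `T` by `σ` with `α ∘ σ = -α`, and `m m' = 2`,
with `t(z) u(x) t(z)⁻¹ = u(z^m x)` (20), `n t(z) n⁻¹ = t(z⁻¹)`, `n² = t((-1)^{m'})` and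
`n u(y) n⁻¹ = u(-y⁻¹) n t(y^{m'}) u(-y⁻¹)` for `y ≠ 0` (19). Proof: the reduction
`exists_rankOneRelations_of_central_of_rootHomBorel` of this file (Bruhat decomposition
7.2.2 (i), the Weyl element of 6.4.12, and the normalisation of `n` on the first page of the
proof of 7.2.4) applied to the theorem `exists_rootHom_sup_isBorelIn_of_central_holds`
(Springer 7.3.3 (ii): `T · U_α` is a Borel subgroup and a Weyl element exists,
`RankOneBorelBruhat.lean`).
[cite: SpringerLAG1998, 7.2.4 (proof, formulas (18)–(20)) with 7.2.2 (i), 7.3.3 (ii)] -/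
theorem exists_rankOneRelations_of_central_holds :
    exists_rankOneRelations_of_central (k := k) (n := n) :=
  exists_rankOneRelations_of_central_of_rootHomBorel exists_rootHom_sup_isBorelIn_of_central_holds

end Holds

end Literature.NumberTheory.Automorphic
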